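import Literature.IUT.HodgeTheaters.DiscreteProfiniteConjugatesProofs
import Literature.IUT.HodgeTheaters.DiscreteProfiniteConjugatesAbelianRank
import Literature.IUT.HodgeTheaters.SurfaceGroupLemma27iv
import Literature.GroupTheory.CombinatorialGroupTheory.SurfaceGroupResiduallyFree
import Literature.GroupTheory.CombinatorialGroupTheory.FreeGroupNoncommutingPair
import Mathlib.GroupTheory.FreeGroup.NielsenSchreier
import HarnessLib

/-!
# [IUTchI] Lemma 2.7 (i), (iii) for orientable surface groups

Topic `Literature/IUT/HodgeTheaters`; theorems only (proof companion; no statement of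
`DiscreteProfiniteConjugates.lean` is touched).  Mochizuki, *Inter-universal Teichmüller Theory
I*, Lemma 2.7 (kurims p. 57; proof p. 58: "well-known … residually finite [free / surface]
groups"): for `G` free of finite rank or an orientable surface group,

* (i) any subgroup generated by two elements is free;
* (iii) for non-commuting `x, y` there are a finite index subgroup `G₁` and `n ≥ 1` with
  `xⁿ, yⁿ ∈ G₁` whose images in `G₁ᵃᵇ` are independent.

The free halves and the reductions `…_of_surfaceCase` are `DiscreteProfiniteConjugatesProofs.lean`
(abc-iut-L5-t9) and `DiscreteProfiniteConjugatesAbelianRank.lean` (abc-iut-L5-t10).  This file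
proves the ORIENTABLE-SURFACE-GROUP halves by *residual freeness* (G. Baumslag 1962): there is a
homomorphism `Φ : G → F₂` keeping `x, y` non-commuting (`SurfaceGroupResiduallyFree.lean`); for
(iii) pull back the free case along `Φ`; for (i), `⟨x, y⟩` maps isomorphically onto the free group
`⟨Φx, Φy⟩` (a non-commuting pair of a free group is a free basis, `FreeGroupNoncommutingPair.lean`),
and a commuting pair generates a cyclic group (Lemma 2.7 (iv), `SurfaceGroupLemma27iv.lean`) on
which a suitable `Φ` is injective.  The residual freeness rests on Baumslag's big powers property
of `z = [p, q] ∈ F₂` (`FreeGroupBigPowers.lean`); `FreeOrSurface.rankTwoInAbelianization_holds` and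
`FreeOrSurface.twoGeneratedSubgroupFree_holds` are Lemma 2.7 (iii) and (i) AS TYPED, unconditionally.

## References

* S. Mochizuki, *Inter-universal Teichmüller Theory I*, PRIMS 57 (2021), Lemma 2.7 (i), (iii).
  [Mochizuki2012]
* G. Baumslag, *On generalised free products*, Math. Z. 78 (1962), Prop. 1, Thm. 1. [Baumslag1962]
-/

noncomputable section

namespace Literature.IUT.HodgeTheaters

open Literature.GroupTheory.CombinatorialGroupTheory

universe u


/-- **Non-commuting elements of an orientable surface group stay non-commuting in a free
quotient** (Baumslag's residual freeness). [cite: Baumslag1962, Thm. 1] -/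
theorem surface_exists_hom_mul_ne {G : Type u} [Group G] (hG : IsOrientableSurfaceGroup G)
    (x y : G) (hxy : x * y ≠ y * x) : ∃ Φ : G →* FreeGroup Bool, Φ x * Φ y ≠ Φ y * Φ x := by
  obtain ⟨g, hg, ⟨e₁⟩⟩ := hG
  obtain ⟨e₂⟩ := exists_mulEquiv_surfaceGroup g
  let e := e₁.trans e₂
  obtain ⟨Ψ, hΨ⟩ := surfaceGroup_exists_hom_mul_ne hg (e x) (e y) (by
    rw [← map_mul, ← map_mul]
    exact fun h => hxy (e.injective h))
  exact ⟨Ψ.comp e.toMonoidHom, hΨ⟩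

/-- **Orientable surface groups are residually free**: `x ≠ 1` survives in some homomorphism to
`F₂`. [cite: Baumslag1962, Thm. 1] -/
theorem surface_exists_hom_ne_one {G : Type u} [Group G] (hG : IsOrientableSurfaceGroup G)
    (x : G) (hx : x ≠ 1) : ∃ Φ : G →* FreeGroup Bool, Φ x ≠ 1 := by
  obtain ⟨g, hg, ⟨e₁⟩⟩ := hG
  obtain ⟨e₂⟩ := exists_mulEquiv_surfaceGroup g
  let e := e₁.trans e₂
  obtain ⟨Ψ, hΨ⟩ := surfaceGroup_residuallyFree hg (e x)
    (fun h => hx (e.injective (h.trans (map_one e).symm)))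
  exact ⟨Ψ.comp e.toMonoidHom, hΨ⟩

/-- **[IUTchI] Lemma 2.7 (iii), orientable-surface-group half**, in the hypothesis shape of `FreeOrSurface.rankTwoInAbelianization_of_surfaceCase` (with `n = 1`): pull back the free
case along a homomorphism `Φ : G → F₂` keeping `x, y` non-commuting.
[cite: Mochizuki2012, Lem 2.7(iii) p.57] -/
theorem rankTwoInAbelianization_surfaceCase :
    ∀ (G : Type u) [Group G], IsOrientableSurfaceGroup G → ∀ x y : G, x * y ≠ y * x →
      ∃ (G₁ : Subgroup G) (n : ℕ) (hx : x ^ n ∈ G₁) (hy : y ^ n ∈ G₁), G₁.FiniteIndex ∧ 0 < n ∧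
        ∀ i j : ℤ, Abelianization.of (⟨x ^ n, hx⟩ : G₁) ^ i *
          Abelianization.of (⟨y ^ n, hy⟩ : G₁) ^ j = 1 → i = 0 ∧ j = 0 := by
  intro G _ hG x y hxy
  obtain ⟨Φ, hΦ⟩ := surface_exists_hom_mul_ne hG x y hxy
  obtain ⟨F₁, hxF, hyF, hfi, hind⟩ := FreeOrSurface.rankTwoInAbelianization_of_isFreeGroup (Φ x) (Φ y) hΦ
  have hidx : (F₁.comap Φ).index ≠ 0 := by
    have h := Subgroup.relIndex_comap_ne_zero Φ (J := F₁) (K := ⊤)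
      (by rw [Subgroup.relIndex_top_right]; exact hfi.index_ne_zero)
    rwa [Subgroup.comap_top, Subgroup.relIndex_top_right] at h
  have hx1 : x ^ 1 ∈ F₁.comap Φ := by rw [pow_one]; exact hxF
  have hy1 : y ^ 1 ∈ F₁.comap Φ := by rw [pow_one]; exact hyF
  refine ⟨F₁.comap Φ, 1, hx1, hy1, ⟨hidx⟩, one_pos, fun i j hij => hind i j ?_⟩
  have ex : (Φ.subgroupComap F₁) ⟨x ^ 1, hx1⟩ = ⟨Φ x, hxF⟩ := Subtype.ext (by simp)
  have ey : (Φ.subgroupComap F₁) ⟨y ^ 1, hy1⟩ = ⟨Φ y, hyF⟩ := Subtype.ext (by simp)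
  have := congrArg (Abelianization.map (Φ.subgroupComap F₁)) hij
  rwa [map_mul, map_zpow, map_zpow, Abelianization.map_of, Abelianization.map_of, map_one, ex,
    ey] at this

/-- For every two elements `x, y` of an orientable surface group there is a homomorphism to `F₂`
injective on `⟨x, y⟩`: if `x, y` do not commute, one keeping them
non-commuting (a non-commuting pair of a free group is a free basis); if they commute, `⟨x, y⟩` is
cyclic (Lemma 2.7 (iv)) and one not killing a generator will do. [cite: Mochizuki2012, Lem 2.7(i) p.57] -/
theorem surface_exists_hom_injOn_closure_pair {G : Type u} [Group G]
    (hG : IsOrientableSurfaceGroup G) (x y : G) :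
    ∃ Φ : G →* FreeGroup Bool, ∀ h ∈ Subgroup.closure ({x, y} : Set G), Φ h = 1 → h = 1 := by
  by_cases hxy : x * y = y * x
  · -- commuting: the closure is cyclic
    have hk : ∀ a ∈ ({x, y} : Set G), ∀ b ∈ ({x, y} : Set G), a * b = b * a := by
      intro a ha b hb
      simp only [Set.mem_insert_iff, Set.mem_singleton_iff] at ha hb
      rcases ha with rfl | rfl <;> rcases hb with rfl | rfl
      · rfl
      · exact hxy
      · exact hxy.symm
      · rfl
    haveI := Subgroup.isMulCommutative_closure hk
    set K := Subgroup.closure ({x, y} : Set G)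
    have hK : ∀ a ∈ K, ∀ b ∈ K, a * b = b * a := fun a ha b hb =>
      congrArg Subtype.val (IsMulCommutative.is_comm.comm (⟨a, ha⟩ : K) ⟨b, hb⟩)
    haveI := abelianSubgroupCyclic_surfaceCase G hG K hK
    obtain ⟨γ, hγ⟩ := exists_zpow_surjective K
    by_cases hγ1 : (γ : G) = 1
    · refine ⟨1, fun h hh _ => ?_⟩
      obtain ⟨k, hk⟩ := hγ ⟨h, hh⟩
      have := congrArg Subtype.val hk
      simp only [SubgroupClass.coe_zpow, hγ1, one_zpow] at this
      exact this.symm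
    · obtain ⟨Φ, hΦ⟩ := surface_exists_hom_ne_one hG γ hγ1
      refine ⟨Φ, fun h hh h1 => ?_⟩
      obtain ⟨k, hk⟩ := hγ ⟨h, hh⟩
      have hk' : (γ : G) ^ k = h := by
        have := congrArg Subtype.val hk
        simpa only [SubgroupClass.coe_zpow] using this
      rw [← hk', map_zpow, IsMulTorsionFree.zpow_eq_one_iff_right hΦ] at h1
      rw [← hk', h1, zpow_zero]
  · -- non-commuting: `Φ` keeping `x, y` non-commuting is injective on `⟨x, y⟩`
    obtain ⟨Φ, hΦ⟩ := surface_exists_hom_mul_ne hG x y hxy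
    refine ⟨Φ, fun h hh h1 => ?_⟩
    let τ : FreeGroup Bool →* G := FreeGroup.lift fun b => cond b x y
    have hτ : τ.range = Subgroup.closure ({x, y} : Set G) := by
      rw [FreeGroup.range_lift_eq_closure]
      congr 1
      ext z
      simp only [Set.mem_range, Bool.exists_bool, cond_false, cond_true, Set.mem_insert_iff,
        Set.mem_singleton_iff]
      constructor
      · rintro (rfl | rfl)
        · exact Or.inr rfl
        · exact Or.inl rfl
      · rintro (rfl | rfl)
        · exact Or.inr rfl
        · exact Or.inl rfl
    have hcomp : Φ.comp τ = FreeGroup.lift fun b => cond b (Φ x) (Φ y) := by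
      refine FreeGroup.ext_hom _ _ fun b => ?_
      cases b <;> simp [τ]
    rw [← hτ] at hh
    obtain ⟨w, rfl⟩ := hh
    have hw : (Φ.comp τ) w = 1 := h1
    rw [hcomp] at hw
    have := FreeGroup.lift_bool_injective_of_mul_ne (Φ x) (Φ y) hΦ (hw.trans (map_one _).symm)
    rw [this, map_one]

/-- **[IUTchI] Lemma 2.7 (i), orientable-surface-group half**, in the hypothesis shape of `FreeOrSurface.twoGeneratedSubgroupFree_of_surfaceCase`: `⟨x, y⟩` is free — it embeds into
`F₂` by `surface_exists_hom_injOn_closure_pair`, and subgroups of free groups are free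
(Nielsen–Schreier). [cite: Mochizuki2012, Lem 2.7(i) p.57] -/
theorem twoGeneratedSubgroupFree_surfaceCase :
    ∀ (G : Type u) [Group G], IsOrientableSurfaceGroup G →
      ∀ x y : G, IsFreeGroup (Subgroup.closure ({x, y} : Set G)) := by
  intro G _ hG x y
  obtain ⟨Φ, hΦ⟩ := surface_exists_hom_injOn_closure_pair hG x y
  set H := Subgroup.closure ({x, y} : Set G)
  have hinj : Function.Injective (Φ.comp H.subtype) := by
    rw [injective_iff_map_eq_one]
    intro h hh
    exact Subtype.ext (hΦ h.1 h.2 hh)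
  exact IsFreeGroup.ofMulEquiv (MonoidHom.ofInjective hinj).symm

/-- **[IUTchI] Lemma 2.7 (iii)** (kurims p. 57) holds as typed: for `G` free of finite rank or an
orientable surface group and non-commuting `x, y ∈ G`, some finite index `G₁` and `n ≥ 1` have
`xⁿ, yⁿ ∈ G₁` with independent images in `G₁ᵃᵇ`. [cite: Mochizuki2012, Lem 2.7(iii) p.57] -/
theorem FreeOrSurface.rankTwoInAbelianization_holds : FreeOrSurface.rankTwoInAbelianization.{u} :=
  FreeOrSurface.rankTwoInAbelianization_of_surfaceCase rankTwoInAbelianization_surfaceCase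

/-- **[IUTchI] Lemma 2.7 (i)** (kurims p. 57) holds as typed: for `G` free of finite rank or an
orientable surface group, every subgroup generated by two elements is free.
[cite: Mochizuki2012, Lem 2.7(i) p.57] -/
theorem FreeOrSurface.twoGeneratedSubgroupFree_holds : FreeOrSurface.twoGeneratedSubgroupFree.{u} :=
  FreeOrSurface.twoGeneratedSubgroupFree_of_surfaceCase twoGeneratedSubgroupFree_surfaceCase


end Literature.IUT.HodgeTheaters
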